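import Mathlib
import HarnessLib

/-!
# The isotypic projection `v ↦ ∫ χ(k) ω(k)v dk` of a unitary representation along a character

Bröcker–tom Dieck, *Representations of Compact Lie Groups* (GTM 98, 1985), Ch. III, Theorem (5.10)
[BrockerTomDieck1985]: for a continuous unitary representation of a compact group `G` on a Hilbert
space `H` and an irreducible character `χ`, the operator `P_χ v = e_χ * v = dim χ · ∫_G χ̄(g) g v dg` is the
ORTHOGONAL PROJECTION onto the `χ`-isotypical part `H_χ` (loc. cit. (i), (iv)); it is self-adjoint by
Lemma (5.4) (`⟨f * a, b⟩ = ⟨a, f˜ * b⟩`) and `G`-equivariant by Lemma (5.5) (`g (u * a) = (g · u) * a`), and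
continuous linear maps pass under the invariant integral by (5.1)(iv).  This file proves the case of a
ONE-DIMENSIONAL character (`dim χ = 1`), which is all that abelian compact groups (tori, `U(1)`, profinite
abelian groups) need, in the following elementary typing: `K` a group with a measurable structure and a
left-invariant probability measure `μ` (the normalised Haar measure of a compact group), a homomorphism
`ω : K →* (E ≃ₗᵢ[ℂ] E)` into the linear isometries of a complex inner-product space `E`, and a unitary
character `χ : K →* Circle`.  Writing `proj μ ω χ v := ∫ k, (χ k : ℂ) • ω k v ∂μ` (this is `P_{χ̄}` of
loc. cit.: `e_{χ̄} = \overline{χ̄} = χ`) and `isoSub ω χ := {v | ∀ k, ω k v = conj (χ k) • v}` for the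
`χ̄`-isotypic subspace:

* `apply_proj` : `ω g (proj v) = conj (χ g) • proj v`, i.e. `proj v ∈ isoSub ω χ` (`proj_mem`) — Lemma (5.5);
* `proj_eq_self` : `proj v = v` on `isoSub ω χ`; `proj_proj` : idempotence; `mem_isoSub_iff_proj_eq` : the
  range is exactly the isotypic subspace — Theorem (5.10)(i),(iv) for `dim χ = 1`;
* `inner_proj`, `inner_proj_comm` : `⟪proj v, w⟫ = ⟪v, proj w⟫` (self-adjoint; uses inversion-invariance
  of `μ`, automatic for compact and for abelian groups) — Lemma (5.4);
* `lift_proj` : a continuous linear `θ` with `θ (ω u φ) = (χ u)⁻¹ • θ φ` satisfies `θ (proj φ) = θ φ`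
  ((5.1)(iv): the `χ`-covariant functional factors through the `χ̄`-isotypic part), and the purely
  algebraic `lift_eq_zero_of_eigen` (a vector on which `K` acts by scalars `c` with `c k ≠ (χ k)⁻¹` for
  some `k` is killed by every such `θ`);
* `integral_chi_inner_eq` : `∫ k, χ k * ⟪φ, ω k φ⟫ ∂μ = ‖proj φ‖ ^ 2`, hence `≥ 0`
  (`integral_chi_inner_nonneg`) and `> 0` iff the `χ̄`-isotypic component of `φ` is non-zero
  (`integral_chi_inner_pos_iff`, `integral_chi_inner_pos_of_mem`) — the standard positivity of the
  "toric integral of a matrix coefficient against a character" at a compact place [folklore].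

Everything is kernel-proved from Mathlib (Bochner integral, `integral_mul_left_eq_self`,
`integral_inv_eq_self`, `ContinuousLinearMap.integral_comp_comm`); continuity hypotheses
(`∀ v, Continuous fun k => ω k v`, `Continuous χ`) appear exactly where an integrand must be integrable,
so no statement holds by a junk value of `∫`.

## Mathlib / tree

Mathlib has `ContRepresentation`, characters of finite groups (`FDRep.character`) and the averaging
projection onto INVARIANTS for finite groups (`Representation.averageMap`, `GroupAlgebra.average`), but
no Haar-integral isotypic projection for compact groups.  The tree's `ContRepresentation`-based files
(`Literature.NumberTheory.Automorphic.HilbertRepIsotypicComponent` / `…Subrepresentations`: the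
`σ`-isotypic component as a closed span of subrepresentations, for any `G`) and the unbundled
`IsUnitaryRep R` of `Literature.RepresentationTheory.Unitary` are a different layer (no integral formula);
a homomorphism `ω : K →* (E ≃ₗᵢ[ℂ] E)` as used here gives either vocabulary through
`LinearIsometryEquiv.toContinuousLinearEquiv`.  No Mathlib or tree declaration is duplicated
(`lean search 'isoSub|integral_chi_inner|IsotypicProjection'`: no hits outside this file).

## Provenance

Staged by the pub-hodgecm formalisation cell (DAG-node prover #02 lineage) under the LEAN-IN-TREE rule;
it supersedes, re-sourced to print, the cell's standalone package file `HodgeCM/PerL34/Isotypic.lean`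
(same declarations and proofs, namespace `HodgeCM.PerL34.Isotypic` ↦
`Literature.RepresentationTheory.CompactGroups.Isotypic`).  Nothing here is a claim of the manuscripts
that cell adjudicates.

## Not here

Characters of dimension `> 1` (the factor `dim χ` and the idempotents `e_χ` of II (4.16)), the Hilbert-sum
decomposition (5.10)(iii), and the Peter–Weyl density theorem (5.7).
-/

noncomputable section

open MeasureTheory Complex ComplexConjugate
open scoped InnerProductSpace

namespace Literature.RepresentationTheory.CompactGroups

namespace Isotypic

variable {K : Type*} [Group K]
variable {E : Type*} [NormedAddCommGroup E] [InnerProductSpace ℂ E]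
variable {F : Type*} [NormedAddCommGroup F] [NormedSpace ℂ F] [CompleteSpace F]

/-- The `χ̄`-isotypic subspace of a representation `ω : K →* (E ≃ₗᵢ[ℂ] E)`: the vectors on which `K` acts
by the character `conj χ = χ⁻¹` (the space `H_{χ̄}` of Bröcker–tom Dieck III (5.10) for a one-dimensional
character). [cite: BrockerTomDieck1985, III (5.10)] -/
def isoSub (ω : K →* (E ≃ₗᵢ[ℂ] E)) (χ : K →* Circle) : Submodule ℂ E where
  carrier := {v | ∀ k, ω k v = conj (χ k : ℂ) • v}
  add_mem' := by
    intro v w hv hw k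
    simp only [Set.mem_setOf_eq] at hv hw ⊢
    rw [map_add, hv k, hw k, smul_add]
  zero_mem' := by
    intro k
    simp
  smul_mem' := by
    intro a v hv k
    simp only [Set.mem_setOf_eq] at hv ⊢
    rw [LinearIsometryEquiv.map_smul, hv k, smul_comm]

/-- Unfolding of `isoSub`. [folklore] -/
theorem mem_isoSub {ω : K →* (E ≃ₗᵢ[ℂ] E)} {χ : K →* Circle} {v : E} :
    v ∈ isoSub ω χ ↔ ∀ k, ω k v = conj (χ k : ℂ) • v := Iff.rfl

section CircleLemmas

variable (χ : K →* Circle)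

/-- `conj (χ k) * χ k = 1` for a unitary character. [folklore] -/
theorem conj_mul_coe (k : K) : conj (χ k : ℂ) * (χ k : ℂ) = 1 := by
  rw [← Circle.coe_inv_eq_conj, ← Circle.coe_mul, inv_mul_cancel, Circle.coe_one]

/-- `χ k * conj (χ k) = 1` for a unitary character. [folklore] -/
theorem coe_mul_conj (k : K) : (χ k : ℂ) * conj (χ k : ℂ) = 1 := by
  rw [mul_comm, conj_mul_coe]

/-- `(χ k)⁻¹ = conj (χ k)` in `ℂ`. [folklore] -/
theorem coe_inv_eq_conj' (k : K) : ((χ k : ℂ))⁻¹ = conj (χ k : ℂ) := by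
  rw [← Circle.coe_inv_eq_conj, Circle.coe_inv]

/-- `χ k⁻¹ = conj (χ k)` in `ℂ`. [folklore] -/
theorem coe_map_inv (k : K) : (χ k⁻¹ : ℂ) = conj (χ k : ℂ) := by
  rw [map_inv, Circle.coe_inv_eq_conj]

end CircleLemmas

variable [MeasurableSpace K]

/-- The **averaging operator** `v ↦ ∫ χ(k) • ω(k) v dμ(k)` — the operator `P_{χ̄} v = e_{χ̄} * v`,
`e_{χ̄} = χ`, of Bröcker–tom Dieck III (5.9)–(5.10) for a one-dimensional character.
[cite: BrockerTomDieck1985, III (5.10)] -/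
def proj (μ : Measure K) (ω : K →* (E ≃ₗᵢ[ℂ] E)) (χ : K →* Circle) (v : E) : E :=
  ∫ k, (χ k : ℂ) • ω k v ∂μ

variable (μ : Measure K) (ω : K →* (E ≃ₗᵢ[ℂ] E)) (χ : K →* Circle)

/-- Unfolding of `proj`. [folklore] -/
theorem proj_def (v : E) : proj μ ω χ v = ∫ k, (χ k : ℂ) • ω k v ∂μ := rfl

section Equivariance

variable [MeasurableMul K] [μ.IsMulLeftInvariant]

/-- **Equivariance** `ω g (proj v) = conj (χ g) • proj v` — the average is `χ̄`-isotypic (left invariance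
of `μ` only; Bröcker–tom Dieck III Lemma (5.5): `g (u * a) = (g · u) * a`).
[cite: BrockerTomDieck1985, III (5.5)] -/
theorem apply_proj (g : K) (v : E) : ω g (proj μ ω χ v) = conj (χ g : ℂ) • proj μ ω χ v := by
  have hcomm := (ω g).toContinuousLinearEquiv.integral_comp_comm (μ := μ) (fun k => (χ k : ℂ) • ω k v)
  simp only [LinearIsometryEquiv.coe_toContinuousLinearEquiv] at hcomm
  rw [proj_def, ← hcomm]
  have h1 : (fun k => ω g ((χ k : ℂ) • ω k v)) =
      fun k => (fun k' => (χ (g⁻¹ * k') : ℂ) • ω k' v) (g * k) := by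
    funext k
    simp only [LinearIsometryEquiv.map_smul, inv_mul_cancel_left, map_mul]
    rfl
  rw [h1, integral_mul_left_eq_self (fun k' => (χ (g⁻¹ * k') : ℂ) • ω k' v) g]
  have h2 : (fun k' => (χ (g⁻¹ * k') : ℂ) • ω k' v) = fun k' => conj (χ g : ℂ) • ((χ k' : ℂ) • ω k' v) := by
    funext k'
    rw [map_mul, Circle.coe_mul, coe_map_inv, smul_smul]
  rw [h2, integral_smul]

/-- The average lies in the `χ̄`-isotypic subspace. [cite: BrockerTomDieck1985, III (5.10)] -/
theorem proj_mem (v : E) : proj μ ω χ v ∈ isoSub ω χ := fun g => apply_proj μ ω χ g v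

end Equivariance

section Fixed

variable [CompleteSpace E] [IsProbabilityMeasure μ]

/-- On the `χ̄`-isotypic subspace the average is the identity (`μ` a probability measure).
[cite: BrockerTomDieck1985, III (5.10)] -/
theorem proj_eq_self {v : E} (hv : v ∈ isoSub ω χ) : proj μ ω χ v = v := by
  rw [proj_def]
  have : (fun k => (χ k : ℂ) • ω k v) = fun _ => v := by
    funext k
    rw [hv k, smul_smul, coe_mul_conj, one_smul]
  rw [this, integral_const]
  simp

variable [MeasurableMul K] [μ.IsMulLeftInvariant]

/-- **Idempotence** `proj (proj v) = proj v` ((5.10)(i): `P_χ` is a projection).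
[cite: BrockerTomDieck1985, III (5.10)] -/
theorem proj_proj (v : E) : proj μ ω χ (proj μ ω χ v) = proj μ ω χ v :=
  proj_eq_self μ ω χ (proj_mem μ ω χ v)

/-- The range of the average is exactly the `χ̄`-isotypic subspace ((5.10)(iv) for `dim χ = 1`).
[cite: BrockerTomDieck1985, III (5.10)] -/
theorem mem_isoSub_iff_proj_eq (v : E) : v ∈ isoSub ω χ ↔ proj μ ω χ v = v :=
  ⟨proj_eq_self μ ω χ, fun h => h ▸ proj_mem μ ω χ v⟩

end Fixed

section Lift

omit [Group K] [MeasurableSpace K] in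
/-- **Algebraic form of "only the corresponding isotypic part contributes"**: if a linear `θ` satisfies
`θ (ρ u φ) = c' u • θ φ` for all `u`, and `K` acts on the vector `φ` through scalars `c k` with `c k ≠ c' k`
for some `k`, then `θ φ = 0`.  No measure, no topology. [folklore] -/
theorem lift_eq_zero_of_eigen {V W : Type*} [AddCommGroup V] [Module ℂ V] [AddCommGroup W] [Module ℂ W]
    (ρ : K → V →ₗ[ℂ] V) (c' : K → ℂ) (θ : V →ₗ[ℂ] W)
    (hθ : ∀ u φ, θ (ρ u φ) = (c' u) • θ φ) {φ : V} (c : K → ℂ)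
    (hφ : ∀ k, ρ k φ = c k • φ) {k : K} (hk : c k ≠ c' k) : θ φ = 0 := by
  have h1 : θ (ρ k φ) = c k • θ φ := by rw [hφ k, map_smul]
  have h2 : θ (ρ k φ) = c' k • θ φ := hθ k φ
  have h3 : (c k - c' k) • θ φ = 0 := by rw [sub_smul, ← h1, ← h2, sub_self]
  rcases smul_eq_zero.mp h3 with h | h
  · exact absurd (sub_eq_zero.mp h) hk
  · exact h

variable [TopologicalSpace K] [OpensMeasurableSpace K] [CompactSpace K] [IsFiniteMeasureOnCompacts μ]

/-- Integrability of the averaging integrand for a strongly continuous representation and a continuous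
character on a compact group. [folklore] -/
theorem integrable_smul_apply (hω : ∀ v, Continuous fun k => ω k v) (hχ : Continuous χ) (v : E) :
    Integrable (fun k => (χ k : ℂ) • ω k v) μ := by
  have h1 : Continuous fun k => (χ k : ℂ) := continuous_subtype_val.comp hχ
  have hc : Continuous fun k => (χ k : ℂ) • ω k v := h1.smul (hω v)
  exact hc.integrable_of_hasCompactSupport (HasCompactSupport.of_compactSpace _)

variable [CompleteSpace E] [IsProbabilityMeasure μ]

/-- **A `χ`-covariant continuous linear map factors through the `χ̄`-isotypic projection**: for a
continuous linear `θ` with `θ (ω u φ) = (χ u)⁻¹ • θ φ`, `θ (proj φ) = θ φ` (continuous linear maps commute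
with the invariant integral, Bröcker–tom Dieck III (5.1)(iv)). [cite: BrockerTomDieck1985, III (5.1)] -/
theorem lift_proj (hω : ∀ v, Continuous fun k => ω k v) (hχ : Continuous χ) (θ : E →L[ℂ] F)
    (hθ : ∀ u φ, θ (ω u φ) = ((χ u : ℂ))⁻¹ • θ φ) (φ : E) : θ (proj μ ω χ φ) = θ φ := by
  rw [proj_def, ← θ.integral_comp_comm (integrable_smul_apply μ ω χ hω hχ φ)]
  have : (fun k => θ ((χ k : ℂ) • ω k φ)) = fun _ => θ φ := by
    funext k
    rw [θ.map_smul, hθ, smul_smul, mul_inv_cancel₀ (Circle.coe_ne_zero (χ k)), one_smul]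
  rw [this, integral_const]
  simp

/-- Hence a `χ`-covariant continuous linear map vanishes on every vector with zero `χ̄`-isotypic
component. [folklore] -/
theorem lift_eq_zero_of_proj_eq_zero (hω : ∀ v, Continuous fun k => ω k v) (hχ : Continuous χ)
    (θ : E →L[ℂ] F) (hθ : ∀ u φ, θ (ω u φ) = ((χ u : ℂ))⁻¹ • θ φ) {φ : E}
    (hφ : proj μ ω χ φ = 0) : θ φ = 0 := by
  rw [← lift_proj μ ω χ hω hχ θ hθ φ, hφ, map_zero]

end Lift

section SelfAdjoint

variable [TopologicalSpace K] [OpensMeasurableSpace K] [CompactSpace K] [IsFiniteMeasureOnCompacts μ]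
variable [CompleteSpace E]

/-- `⟪v, proj w⟫ = ∫ χ k * ⟪v, ω k w⟫` (the inner product passes under the integral). [folklore] -/
theorem inner_proj (hω : ∀ v, Continuous fun k => ω k v) (hχ : Continuous χ) (v w : E) :
    ⟪v, proj μ ω χ w⟫_ℂ = ∫ k, (χ k : ℂ) * ⟪v, ω k w⟫_ℂ ∂μ := by
  rw [proj_def, ← integral_inner (integrable_smul_apply μ ω χ hω hχ w)]
  congr 1
  funext k
  rw [inner_smul_right]

variable [MeasurableInv K] [μ.IsInvInvariant]

/-- **Self-adjointness** of the average, `⟪proj v, w⟫ = ⟪v, proj w⟫` (Bröcker–tom Dieck III Lemma (5.4)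
with `f = χ`, `f˜(g) = \overline{f(g⁻¹)} = χ(g)`; uses inversion-invariance of `μ`, which holds for the
Haar measure of every compact group and of every abelian group). [cite: BrockerTomDieck1985, III (5.4)] -/
theorem inner_proj_comm (hω : ∀ v, Continuous fun k => ω k v) (hχ : Continuous χ) (v w : E) :
    ⟪proj μ ω χ v, w⟫_ℂ = ⟪v, proj μ ω χ w⟫_ℂ := by
  rw [← inner_conj_symm, inner_proj μ ω χ hω hχ, inner_proj μ ω χ hω hχ, ← integral_conj]
  rw [← integral_inv_eq_self (fun k => (χ k : ℂ) * ⟪v, ω k w⟫_ℂ) μ]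
  congr 1
  funext k
  rw [map_mul, inner_conj_symm, ← coe_map_inv]
  congr 1
  rw [LinearIsometryEquiv.inner_map_eq_flip, map_inv, LinearIsometryEquiv.inv_def]

end SelfAdjoint

section ToricIntegral

variable [MeasurableMul K] [MeasurableInv K] [μ.IsMulLeftInvariant] [μ.IsInvInvariant]
variable [TopologicalSpace K] [OpensMeasurableSpace K] [CompactSpace K] [IsProbabilityMeasure μ]
variable [CompleteSpace E]

/-- **The toric integral of a matrix coefficient against a character is a squared norm**:
`∫ χ(k) ⟪φ, ω(k) φ⟫ dμ(k) = ‖proj φ‖ ^ 2`, the squared norm of the `χ̄`-isotypic component of `φ`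
(`μ` the probability Haar measure; `P` an orthogonal projection gives `⟪φ, P φ⟫ = ‖P φ‖²`). [folklore] -/
theorem integral_chi_inner_eq (hω : ∀ v, Continuous fun k => ω k v) (hχ : Continuous χ) (φ : E) :
    ∫ k, (χ k : ℂ) * ⟪φ, ω k φ⟫_ℂ ∂μ = ((‖proj μ ω χ φ‖ ^ 2 : ℝ) : ℂ) := by
  rw [← inner_proj μ ω χ hω hχ, ← proj_proj μ ω χ φ, ← inner_proj_comm μ ω χ hω hχ,
    proj_proj, inner_self_eq_norm_sq_to_K]
  norm_cast

/-- Hence the toric integral has non-negative real part … [folklore] -/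
theorem integral_chi_inner_nonneg (hω : ∀ v, Continuous fun k => ω k v) (hχ : Continuous χ) (φ : E) :
    0 ≤ (∫ k, (χ k : ℂ) * ⟪φ, ω k φ⟫_ℂ ∂μ).re := by
  rw [integral_chi_inner_eq μ ω χ hω hχ, Complex.ofReal_re]
  positivity

/-- … and is `> 0` iff the `χ̄`-isotypic component of `φ` is non-zero. [folklore] -/
theorem integral_chi_inner_pos_iff (hω : ∀ v, Continuous fun k => ω k v) (hχ : Continuous χ) (φ : E) :
    0 < (∫ k, (χ k : ℂ) * ⟪φ, ω k φ⟫_ℂ ∂μ).re ↔ proj μ ω χ φ ≠ 0 := by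
  rw [integral_chi_inner_eq μ ω χ hω hχ, Complex.ofReal_re]
  constructor
  · intro h h0
    rw [h0, norm_zero] at h
    norm_num at h
  · intro h
    have : 0 < ‖proj μ ω χ φ‖ := norm_pos_iff.mpr h
    positivity

/-- In particular the toric integral is `> 0` for every non-zero `χ̄`-isotypic vector `φ`. [folklore] -/
theorem integral_chi_inner_pos_of_mem (hω : ∀ v, Continuous fun k => ω k v) (hχ : Continuous χ)
    {φ : E} (hφ : φ ∈ isoSub ω χ) (hne : φ ≠ 0) :
    0 < (∫ k, (χ k : ℂ) * ⟪φ, ω k φ⟫_ℂ ∂μ).re := by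
  rw [integral_chi_inner_pos_iff μ ω χ hω hχ, proj_eq_self μ ω χ hφ]
  exact hne

end ToricIntegral

end Isotypic

end Literature.RepresentationTheory.CompactGroups

end
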